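import Literature.NumberTheory.EllipticCurves.BurungaleKobayashiNakamuraOta2026.RubinPadicLFunctionValuesProofs
import HarnessLib

/-!
# Stub-ideation k = 3 (gen 8) for `stub_heegnerIndexLowerAtTwo` — crux `PrintCf2.SplitBadTwoLowerHalfOfFacts`
# (stmt-BirchSwinnertonDyer-27851), technique «decomposition»: T3's Waldspurger-constant input `H_W`
# split as  KEY-RIGIDITY (REL)  +  ONE TRANSPORT-CERTIFIED CALIBRATION PER 2-ADIC KEY (CAL)  +  regime glue (EC, proved)

Seat `sidea-stub_heegnerIndexLowerAtTwo-3-g8` (planner, stub-ideation; scratch sketch, NOT a proposal, NOT a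
skeleton; nothing is asserted about the stub, the crux or BSD — BSD is NOT proved by any of this).

THE NODE. In the odd-coset engine of STUB-PLAN v2.1 §1 T3 (k1-g6 `OddCosetWitness`, k3-g7 `H_B/H_C/H_W`) the
S2′⁻ value law `‖G0‖·‖Lin‖ ≤ 2^c·‖S⋆‖²` needs ONE research number per dyadic key: the uniform bound
`∀ n, ‖w_n‖ ≤ 2^c` on the in-range constants `w_n := Ka_n·Kb_n / S_n²` (Katz (36)–(37) twice over explicit
Waldspurger), SHARP (c enters `e_A⁻ = 4e − 2c − ρ + 2g + 2β` with coefficient −2).  v2.1's HARDEST NOW is exactly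
the ABSOLUTE pin of this constant ((W-b)′ period ratio, R46/R47), and every bookkeeping incident B15/B16
(hat–avatar `p^{-n}`, the (37) prefactor `n_v(k − ½)`, P-c₀) was an ABSOLUTE or LEVEL-dependent 2-adic digit.

THE SPLIT (this file): `bound` ⟸ REL ∧ CAL ∧ EC, where
* REL (research-XS, «reading, not evaluating»): for two class members `d ≡ d₀` in the SAME dyadic key (same
  pair-menu entry) the constants agree in norm up to an explicit ODD-place digit, `‖w_n(d)‖ = 2^δ·‖w_n(d₀)‖`
  for `n ≥ n₁` — because each printed constant is a product of LOCAL factors and the factors at `v ∣ 2` see only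
  `χ'_v = χ_{d,2}` (= the key): de Shalit II.4.14 (36)–(37) (`G(ε)` depends on `(k, j, ε_𝔭)`; `(1 − ε(𝔭)/p) = 1`,
  W additive) [deShalit1987 p. 71]; CH18 Prop. 3.4 = Hsieh's explicit Waldspurger (constant
  `2^{#A(χ)+3} u_K² √D_K · c · (Im ϑ)^{2r} χ^{-1}(𝔑) ε(f)`, `e_𝔭·ε(½,χ_𝔭)² = 1` for `p ∣ c`; d enters through
  `#A(χ) = [7 ∣ d]` and units) [arXiv:1505.08165 p. 10]; LZZ Thm 3.8 [arXiv:1511.08172 p. 18].  Absolute digits,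
  level digits, periods `Ω_p, Ω_∞, P_ι`, Petersson norms and Gauss sums of WILD 2-adic characters all CANCEL in REL.
* CAL (a COMPUTATION fact, one per key, B8-clean — no BSD input): at the smallest member `d₀` of the key and ONE
  level `n₀`, the three exact algebraic numbers `Ka_{n₀}(d₀), Kb_{n₀}(d₀), S_{n₀}(d₀)` satisfy three threshold
  inequalities (below) and `‖Ka‖‖Kb‖ = 2^c‖S‖²`; the thresholds CERTIFY that level `n₀` is already in the
  constant regime, so `c(key) := ord` read off at `n₀` IS the limit constant (no period theory, no digit tables).
* EC (PROVED here, generic ultrametric analysis on `ℂ₂`): tail bounds (Katz side IN TREE: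
  `IntSeries.norm_sub_constantCoeff_le`, rate `‖T_n‖ = 2^{-(n+2)}`; partner branch: the Lipschitz lemma §2; BDP side:
  k3-g7's HB1 rate `2^{-(n+1)}`, print) + thresholds at `n₀` ⟹ the norms of `Ka_n, Kb_n, S_n` are CONSTANT for
  `n ≥ n₀` and equal to the norms of the limits (§1 `norm_eq_of_threshold`) ⟹ the anchor's exact law at every
  later level and AT THE LIMIT (§3) ⟹ with REL the member's exact law and its limit (§4) ⟹ the TWO-SIDED value
  law `‖G0‖‖Lin‖ = 2^{c+δ}‖S⋆‖²`, whence S2′ two-sided and both children's inequalities (§5).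
BONUS: sharp `c` makes T3 two-sided (customers: parent 20368, UPPER sibling 27850); the BSD-known anchors
`d ∈ {−1, ±2}` become independent CHECKS (R25 (b)(c)), not calibration inputs.
-/

set_option autoImplicit false
set_option linter.dupNamespace false

noncomputable section

open Filter Topology
open Literature.NumberTheory.EllipticCurves

namespace Summit.BirchSwinnertonDyer.BirchSwinnertonDyer.Cruxes.SplitBadTwoLowerHalfOfFacts.StubIdeasK3G8

/-! ## §1 The in-regime lemma and regime propagation (helper lemmas H1, H2 — PROVED) -/

section Regime

variable {p : ℕ} [Fact p.Prime]

/-- **H1 (ultrametric in-regime lemma).** `‖a − b‖ < ‖b‖ ⟹ ‖a‖ = ‖b‖` in `ℂ_p`.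
[cite: Serre1979, Ch. II §1] -/
theorem norm_eq_of_norm_sub_lt {a b : ℂ_[p]} (h : ‖a - b‖ < ‖b‖) : ‖a‖ = ‖b‖ := by
  calc ‖a‖ = ‖b + (a - b)‖ := by rw [add_sub_cancel]
    _ = max ‖b‖ ‖a - b‖ := IsUltrametricDist.norm_add_eq_max_of_norm_ne_norm (ne_of_gt h)
    _ = ‖b‖ := max_eq_left h.le

/-- **H2 (regime propagation).** A sequence `a_n → α` with tail bound `‖a_n − α‖ ≤ r_n` (`r` non-increasing
from `n₀` on) whose value at ONE index beats the rate, `r_{n₀} < ‖a_{n₀}‖`, has CONSTANT norm from `n₀` on, equal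
to `‖α‖`; in particular `α ≠ 0` is certified, not assumed. [cite: Serre1979, Ch. II §1] -/
theorem norm_eq_of_threshold {a : ℕ → ℂ_[p]} {α : ℂ_[p]} {r : ℕ → ℝ} {n₀ : ℕ}
    (htail : ∀ n, n₀ ≤ n → ‖a n - α‖ ≤ r n) (hanti : ∀ n, n₀ ≤ n → r n ≤ r n₀)
    (hthr : r n₀ < ‖a n₀‖) :
    ‖α‖ = ‖a n₀‖ ∧ ∀ n, n₀ ≤ n → ‖a n‖ = ‖a n₀‖ := by
  have hα : ‖α‖ = ‖a n₀‖ := by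
    refine norm_eq_of_norm_sub_lt ?_
    rw [norm_sub_rev]
    exact (htail n₀ le_rfl).trans_lt hthr
  refine ⟨hα, fun n hn => ?_⟩
  have hlt : ‖a n - α‖ < ‖α‖ :=
    calc ‖a n - α‖ ≤ r n := htail n hn
      _ ≤ r n₀ := hanti n hn
      _ < ‖a n₀‖ := hthr
      _ = ‖α‖ := hα.symm
  rw [norm_eq_of_norm_sub_lt hlt, hα]

/-- The certified non-vanishing of the limit. [cite: Serre1979, Ch. II §1] -/
theorem ne_zero_of_threshold {a : ℕ → ℂ_[p]} {α : ℂ_[p]} {r : ℕ → ℝ} {n₀ : ℕ}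
    (htail : ∀ n, n₀ ≤ n → ‖a n - α‖ ≤ r n) (hanti : ∀ n, n₀ ≤ n → r n ≤ r n₀)
    (hthr : r n₀ < ‖a n₀‖) : α ≠ 0 := by
  intro h0
  have h := (norm_eq_of_threshold htail hanti hthr).1
  rw [h0, norm_zero] at h
  have : (0 : ℝ) ≤ r n₀ := (norm_nonneg _).trans (htail n₀ le_rfl)
  linarith [h ▸ hthr]

end Regime

/-! ## §2 The two tail rates on the Katz side (helper lemma H3 — PROVED; the BDP-side rate is k3-g7's HB1, print) -/

section KatzRates

variable {p : ℕ} [Fact p.Prime]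

/-- **H3a (branch at points accumulating at `T = 0`).** For the LEAD's Katz–de Shalit branch `G ∈ 𝒪_{ℂ_p}⟦T⟧` with
values `Ka_n = G(T_n)`: `‖Ka_n − G(0)‖ ≤ ‖T_n‖` (tree: `IntSeries.norm_sub_constantCoeff_le`; on the odd coset
`‖T_n‖ = ‖u^{2^n} − 1‖ = 2^{-(n+2)}`). [cite: Washington1997, §7.2] -/
theorem katz_tail_at_zero (G : PowerSeries (PadicComplexInt p)) {T Ka : ℕ → ℂ_[p]}
    (hval : ∀ n, IntSeries.HasValueAt G (T n) (Ka n)) (hT : ∀ n, ‖T n‖ ≤ 1) (n : ℕ) :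
    ‖Ka n - ((PowerSeries.constantCoeff G : PadicComplexInt p) : ℂ_[p])‖ ≤ ‖T n‖ :=
  IntSeries.norm_sub_constantCoeff_le (hval n) (hT n)

/-- `‖x^k − y^k‖ ≤ ‖x − y‖` on the closed unit disc of `ℂ_p`. [cite: Serre1979, Ch. II §1] -/
theorem norm_pow_sub_pow_le {x y : ℂ_[p]} (hx : ‖x‖ ≤ 1) (hy : ‖y‖ ≤ 1) (k : ℕ) :
    ‖x ^ k - y ^ k‖ ≤ ‖x - y‖ := by
  induction k with
  | zero => simp
  | succ k ih =>
    have hsplit : x ^ (k + 1) - y ^ (k + 1) = x * (x ^ k - y ^ k) + (x - y) * y ^ k := by ring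
    rw [hsplit]
    refine (IsUltrametricDist.norm_add_le_max _ _).trans (max_le ?_ ?_)
    · rw [norm_mul]
      calc ‖x‖ * ‖x ^ k - y ^ k‖ ≤ 1 * ‖x - y‖ :=
            mul_le_mul hx ih (norm_nonneg _) zero_le_one
        _ = ‖x - y‖ := one_mul _
    · rw [norm_mul, norm_pow]
      exact mul_le_of_le_one_right (norm_nonneg _) (pow_le_one₀ (norm_nonneg _) hy)

/-- **H3b (Lipschitz-1 on the closed disc: the PARTNER branch at points accumulating at an in-range point).**
For `Q ∈ 𝒪_{ℂ_p}⟦T⟧` and `‖x‖, ‖y‖ ≤ 1` (values existing): `‖Q(x) − Q(y)‖ ≤ ‖x − y‖` — so `‖Kb_n − Lin‖ ≤ ‖T'_n − T'_⋆‖`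
for the partner values `Kb_n = G'(T'_n)`, `Lin = G'(T'_⋆)`. [cite: Washington1997, §7.2] -/
theorem norm_sub_le_of_hasValueAt₂ (Q : PowerSeries (PadicComplexInt p)) {x y v w : ℂ_[p]}
    (hx : ‖x‖ ≤ 1) (hy : ‖y‖ ≤ 1) (hv : IntSeries.HasValueAt Q x v) (hw : IntSeries.HasValueAt Q y w) :
    ‖v - w‖ ≤ ‖x - y‖ := by
  have hsum : HasSum (fun k : ℕ ↦ ((PowerSeries.coeff k Q : PadicComplexInt p) : ℂ_[p]) * x ^ k -
      ((PowerSeries.coeff k Q : PadicComplexInt p) : ℂ_[p]) * y ^ k) (v - w) := hv.sub hw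
  rw [← hsum.tsum_eq]
  refine IsUltrametricDist.norm_tsum_le_of_forall_le_of_nonneg (norm_nonneg (x - y)) fun k ↦ ?_
  rw [← mul_sub, norm_mul]
  calc ‖((PowerSeries.coeff k Q : PadicComplexInt p) : ℂ_[p])‖ * ‖x ^ k - y ^ k‖ ≤ 1 * ‖x - y‖ :=
        mul_le_mul (norm_coe_padicComplexInt_le_one _) (norm_pow_sub_pow_le hx hy k) (norm_nonneg _)
          zero_le_one
    _ = ‖x - y‖ := one_mul _

end KatzRates

/-! ## §3 CAL: the calibration certificate at one member and one level, and the anchor's exact law (PROVED glue) -/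

/-- **Tail data** of an odd-coset triple toward its limits, with rates non-increasing from `n₀` on (Katz side: §2,
rate `2^{-(n+2)}`; BDP side: k3-g7 HB1 + HB2 contraction, rate `2^{-(n+1)}`, PRINT [Katz 1976 §2.6; Hida GTM 258
§1.3.5]). [cite: Washington1997, §7.2] -/
structure Tails (Ka Kb S : ℕ → ℂ_[2]) (G0 Lin Sstar : ℂ_[2]) (rKa rKb rS : ℕ → ℝ) (n₀ : ℕ) : Prop where
  tailKa : ∀ n, n₀ ≤ n → ‖Ka n - G0‖ ≤ rKa n
  tailKb : ∀ n, n₀ ≤ n → ‖Kb n - Lin‖ ≤ rKb n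
  tailS : ∀ n, n₀ ≤ n → ‖S n - Sstar‖ ≤ rS n
  antiKa : ∀ n, n₀ ≤ n → rKa n ≤ rKa n₀
  antiKb : ∀ n, n₀ ≤ n → rKb n ≤ rKb n₀
  antiS : ∀ n, n₀ ≤ n → rS n ≤ rS n₀

/-- **CAL — the calibration certificate** (sub-stub, a COMPUTATION fact per dyadic key; research-0 mathematics,
one certified exact computation): at level `n₀` the three computed norms beat the three rates (so `n₀` is in the
constant regime, by §1) and the in-range identity reads `‖Ka‖·‖Kb‖ = 2^c·‖S‖²` — this DEFINES the key's constant
`c`. Inputs to the computation: Katz's (36)–(37) constant at ONE ramified critical character (de Shalit II.4.14)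
times an Eisenstein–Kronecker (Damerell) value in a field of degree ≤ 4; the partner value likewise; ONE finite CM
sum of nearly-holomorphic derivatives `δ^{j}f₀` over `Pic 𝒪_c` recognised in `ℚ(f₀, χ')`; all three are algebraic,
so their `ι₂`-valuations are exact. [cite: deShalit1987, II.4.14 (36)–(37) p. 71] -/
structure Calibration (Ka Kb S : ℕ → ℂ_[2]) (rKa rKb rS : ℕ → ℝ) (n₀ : ℕ) (c : ℤ) : Prop where
  thrKa : rKa n₀ < ‖Ka n₀‖
  thrKb : rKb n₀ < ‖Kb n₀‖
  thrS : rS n₀ < ‖S n₀‖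
  value : ‖Ka n₀‖ * ‖Kb n₀‖ = (2 : ℝ) ^ c * ‖S n₀‖ ^ 2

/-- **EC-1 (PROVED): the calibration propagates.** Certificate at `n₀` + tails ⟹ the exact law at EVERY level
`n ≥ n₀`, the exact law AT THE LIMIT `‖G0‖·‖Lin‖ = 2^c·‖S⋆‖²`, and the three limits are non-zero (K10-safe: `G0 ≠ 0`
is certified by the computation). [cite: Serre1979, Ch. II §1] -/
theorem anchor_exact_law {Ka Kb S : ℕ → ℂ_[2]} {G0 Lin Sstar : ℂ_[2]} {rKa rKb rS : ℕ → ℝ} {n₀ : ℕ} {c : ℤ}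
    (hC : Calibration Ka Kb S rKa rKb rS n₀ c) (hT : Tails Ka Kb S G0 Lin Sstar rKa rKb rS n₀) :
    (∀ n, n₀ ≤ n → ‖Ka n‖ * ‖Kb n‖ = (2 : ℝ) ^ c * ‖S n‖ ^ 2) ∧
      ‖G0‖ * ‖Lin‖ = (2 : ℝ) ^ c * ‖Sstar‖ ^ 2 ∧ G0 ≠ 0 ∧ Lin ≠ 0 ∧ Sstar ≠ 0 := by
  obtain ⟨hG0, hKa⟩ := norm_eq_of_threshold hT.tailKa hT.antiKa hC.thrKa
  obtain ⟨hLin, hKb⟩ := norm_eq_of_threshold hT.tailKb hT.antiKb hC.thrKb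
  obtain ⟨hSst, hS⟩ := norm_eq_of_threshold hT.tailS hT.antiS hC.thrS
  refine ⟨fun n hn => ?_, ?_, ne_zero_of_threshold hT.tailKa hT.antiKa hC.thrKa,
    ne_zero_of_threshold hT.tailKb hT.antiKb hC.thrKb, ne_zero_of_threshold hT.tailS hT.antiS hC.thrS⟩
  · rw [hKa n hn, hKb n hn, hS n hn]; exact hC.value
  · rw [hG0, hLin, hSst]; exact hC.value

/-! ## §4 REL: key-rigidity, and the member's exact law (PROVED glue) -/

/-- **REL — key-rigidity of the in-range constants** (sub-stub, research-XS: a READING of the printed constants).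
For a class member `d` and the key's calibration member `d₀` (same dyadic key `[d]₂ = [d₀]₂`, same pair-menu entry),
with in-range constants `w_n(d)`, `w_n(d₀)` (`Ka·Kb = w·S²` at each level): from some level on
`‖w_n(d)‖ = 2^δ · ‖w_n(d₀)‖` with `δ = δ(d, d₀)` an EXPLICIT odd-place digit (`#A(χ') = [7 ∣ d]` in CH18 Prop. 3.4;
the local toric constant at 7; `0` at every `q ∣ d`, `q ∤ 14`, where all factors are 2-adic units).  WHY: Katz's
constant `Ω_p^{j−k}Ω^{k−j}(√d_K/2π)^j G(ε)(1 − ε(𝔭)/p)` has `G(ε)` a function of `(k, j, ε_𝔭)` only and the Euler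
factor `= 1` (W additive at 2); the Waldspurger constant is `2^{#A(χ)+3}u_K²√D_K·c·(Im ϑ)^{2r}χ^{-1}(𝔑)ε(f)` times
local terms; at `v ∣ 2` every factor sees only `χ'_v = χ_{d,2}`, i.e. the key.  No absolute digit, no level digit,
no period and no wild Gauss sum is evaluated. [cite: arXiv:1505.08165, Prop. 3.4 p. 10; deShalit1987 II.4.14 p. 71;
arXiv:1511.08172 Thm. 3.8 p. 18] -/
def KeyRigid (w w₀ : ℕ → ℂ_[2]) (δ : ℤ) : Prop :=
  ∃ n₁ : ℕ, ∀ n, n₁ ≤ n → ‖w n‖ = (2 : ℝ) ^ δ * ‖w₀ n‖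

/-- **EC-2 (PROVED): the anchor's constant is read off exactly.** Under the anchor's exact law at levels `n ≥ N₀` and
`S₀ n ≠ 0` there, the in-range identity gives `‖w₀ n‖ = 2^c` for `n ≥ N₀`. [cite: Serre1979, Ch. II §1] -/
theorem norm_w_anchor {Ka₀ Kb₀ S₀ w₀ : ℕ → ℂ_[2]} {c : ℤ} {N₀ : ℕ}
    (hid₀ : ∀ n, Ka₀ n * Kb₀ n = w₀ n * S₀ n ^ 2)
    (hlaw₀ : ∀ n, N₀ ≤ n → ‖Ka₀ n‖ * ‖Kb₀ n‖ = (2 : ℝ) ^ c * ‖S₀ n‖ ^ 2)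
    (hS₀ : ∀ n, N₀ ≤ n → S₀ n ≠ 0) (n : ℕ) (hn : N₀ ≤ n) : ‖w₀ n‖ = (2 : ℝ) ^ c := by
  have h1 : ‖Ka₀ n‖ * ‖Kb₀ n‖ = ‖w₀ n‖ * ‖S₀ n‖ ^ 2 := by
    rw [← norm_mul, hid₀ n, norm_mul, norm_pow]
  have hSn : ‖S₀ n‖ ^ 2 ≠ 0 := pow_ne_zero 2 (norm_ne_zero_iff.mpr (hS₀ n hn))
  exact mul_right_cancel₀ hSn (h1.symm.trans (hlaw₀ n hn))

/-- **EC-3 (PROVED): the member's exact law at every late level.** In-range identities for member and anchor, the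
anchor's exact law (EC-1) and key-rigidity REL ⟹ `‖Ka_n‖·‖Kb_n‖ = 2^{c+δ}·‖S_n‖²` for `n ≥ max N₀ n₁`.
[cite: arXiv:1505.08165, Prop. 3.4 p. 10] -/
theorem member_exact_law {Ka Kb S w Ka₀ Kb₀ S₀ w₀ : ℕ → ℂ_[2]} {c δ : ℤ} {N₀ n₁ : ℕ}
    (hid : ∀ n, Ka n * Kb n = w n * S n ^ 2) (hid₀ : ∀ n, Ka₀ n * Kb₀ n = w₀ n * S₀ n ^ 2)
    (hlaw₀ : ∀ n, N₀ ≤ n → ‖Ka₀ n‖ * ‖Kb₀ n‖ = (2 : ℝ) ^ c * ‖S₀ n‖ ^ 2)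
    (hS₀ : ∀ n, N₀ ≤ n → S₀ n ≠ 0) (hrig : ∀ n, n₁ ≤ n → ‖w n‖ = (2 : ℝ) ^ δ * ‖w₀ n‖) :
    ∀ n, max N₀ n₁ ≤ n → ‖Ka n‖ * ‖Kb n‖ = (2 : ℝ) ^ (c + δ) * ‖S n‖ ^ 2 := by
  intro n hn
  have hN₀ : N₀ ≤ n := (le_max_left _ _).trans hn
  have hn₁ : n₁ ≤ n := (le_max_right _ _).trans hn
  have hw₀ : ‖w₀ n‖ = (2 : ℝ) ^ c := norm_w_anchor hid₀ hlaw₀ hS₀ n hN₀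
  rw [← norm_mul, hid n, norm_mul, norm_pow, hrig n hn₁, hw₀, zpow_add₀ (two_ne_zero' ℝ)]
  ring

/-- **EC-4 (PROVED): pass to the limit.** An exact law holding at every late level passes to the limits of the
three sequences: `‖G0‖·‖Lin‖ = C·‖S⋆‖²`. (The member's limits exist: Katz continuity §2; BDP side H_B.)
[cite: Washington1997, §7.2] -/
theorem limit_exact_law {Ka Kb S : ℕ → ℂ_[2]} {G0 Lin Sstar : ℂ_[2]} {C : ℝ} {N : ℕ}
    (hKa : Tendsto Ka atTop (𝓝 G0)) (hKb : Tendsto Kb atTop (𝓝 Lin)) (hS : Tendsto S atTop (𝓝 Sstar))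
    (hlaw : ∀ n, N ≤ n → ‖Ka n‖ * ‖Kb n‖ = C * ‖S n‖ ^ 2) :
    ‖G0‖ * ‖Lin‖ = C * ‖Sstar‖ ^ 2 := by
  have hf : Tendsto (fun n => ‖Ka n‖ * ‖Kb n‖) atTop (𝓝 (‖G0‖ * ‖Lin‖)) := hKa.norm.mul hKb.norm
  have hg : Tendsto (fun n => C * ‖S n‖ ^ 2) atTop (𝓝 (C * ‖Sstar‖ ^ 2)) :=
    (hS.norm.pow 2).const_mul C
  have hfg : (fun n => ‖Ka n‖ * ‖Kb n‖) =ᶠ[atTop] fun n => C * ‖S n‖ ^ 2 :=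
    Filter.eventually_atTop.mpr ⟨N, hlaw⟩
  exact tendsto_nhds_unique hf (hg.congr' hfg.symm)

/-- **The assembled decomposition `H_W ⟸ REL ∧ CAL ∧ EC` (PROVED from the two sub-stubs + tails + limits):**
calibration certificate and tails at the key's anchor member, the in-range identities, key-rigidity, and the
existence of the member's three limits ⟹ the member's TWO-SIDED value law `‖G0‖·‖Lin‖ = 2^{c+δ}·‖S⋆‖²` (sharp
constant; the engine's one-sided `OddCosetValueLaw G0 Lin S⋆ (c+δ)` is its `≤` half).
[cite: deShalit1987, II.4.14 p. 71; arXiv:1505.08165 Prop. 3.4 p. 10] -/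
theorem valueLaw_of_rel_cal
    {Ka Kb S w Ka₀ Kb₀ S₀ w₀ : ℕ → ℂ_[2]} {G0 Lin Sstar G0₀ Lin₀ Sstar₀ : ℂ_[2]}
    {rKa rKb rS : ℕ → ℝ} {n₀ : ℕ} {c δ : ℤ}
    (hC : Calibration Ka₀ Kb₀ S₀ rKa rKb rS n₀ c) (hT : Tails Ka₀ Kb₀ S₀ G0₀ Lin₀ Sstar₀ rKa rKb rS n₀)
    (hid : ∀ n, Ka n * Kb n = w n * S n ^ 2) (hid₀ : ∀ n, Ka₀ n * Kb₀ n = w₀ n * S₀ n ^ 2)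
    (hrig : KeyRigid w w₀ δ)
    (hKa : Tendsto Ka atTop (𝓝 G0)) (hKb : Tendsto Kb atTop (𝓝 Lin)) (hS : Tendsto S atTop (𝓝 Sstar)) :
    ‖G0‖ * ‖Lin‖ = (2 : ℝ) ^ (c + δ) * ‖Sstar‖ ^ 2 := by
  obtain ⟨hlaw₀, -, -, -, -⟩ := anchor_exact_law hC hT
  have hS₀ : ∀ n, n₀ ≤ n → S₀ n ≠ 0 := by
    intro n hn h0
    obtain ⟨-, hSn⟩ := norm_eq_of_threshold hT.tailS hT.antiS hC.thrS
    have h := hSn n hn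
    rw [h0, norm_zero] at h
    have : (0 : ℝ) ≤ rS n₀ := (norm_nonneg _).trans (hT.tailS n₀ le_rfl)
    linarith [hC.thrS]
  obtain ⟨n₁, hrig⟩ := hrig
  exact limit_exact_law hKa hKb hS (member_exact_law hid hid₀ hlaw₀ hS₀ hrig)

/-! ## §5 Engine hook-up: the two-sided law gives S2′ exactly, hence BOTH children's inequalities (PROVED bookkeeping) -/

/-- **Exponent extraction (PROVED).** With `‖G0‖ = 2^{-m/2}` (S2′'s analytic binder), `‖Lin‖ = 2^{-ρ/2 − a}`
((W-c), in range, exact) and `‖S⋆‖ = 2^{-σ}` (H_C two-sided, `σ = e + k + ℓ`), the exact law with constant `2^C`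
reads `m = 4σ − 2C − ρ − 2a`. [cite: KrizLi2019, Thm. 2.8 (arXiv:1609.06687 p. 23)] -/
theorem m_eq_of_exact_law {G0 Lin Sstar : ℂ_[2]} {m ρ a σ C : ℤ}
    (hG : ‖G0‖ = (2 : ℝ) ^ (-(m : ℝ) / 2)) (hL : ‖Lin‖ = (2 : ℝ) ^ (-(ρ : ℝ) / 2 - a))
    (hS : ‖Sstar‖ = (2 : ℝ) ^ (-(σ : ℝ)))
    (hlaw : ‖G0‖ * ‖Lin‖ = (2 : ℝ) ^ (C : ℝ) * ‖Sstar‖ ^ 2) :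
    m = 4 * σ - 2 * C - ρ - 2 * a := by
  have h2 : (0 : ℝ) < 2 := two_pos
  rw [hG, hL, hS, ← Real.rpow_add h2, ← Real.rpow_natCast, ← Real.rpow_mul h2.le, ← Real.rpow_add h2] at hlaw
  have hexp : -(m : ℝ) / 2 + (-(ρ : ℝ) / 2 - a) = (C : ℝ) + -(σ : ℝ) * ((2 : ℕ) : ℝ) := by
    rcases lt_trichotomy (-(m : ℝ) / 2 + (-(ρ : ℝ) / 2 - a)) ((C : ℝ) + -(σ : ℝ) * ((2 : ℕ) : ℝ)) with h | h | h
    · exact absurd hlaw (ne_of_lt (Real.rpow_lt_rpow_of_exponent_lt one_lt_two h))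
    · exact h
    · exact absurd hlaw (ne_of_gt (Real.rpow_lt_rpow_of_exponent_lt one_lt_two h))
  have hcast : ((m : ℝ)) = 4 * σ - 2 * C - ρ - 2 * a := by
    push_cast at hexp ⊢
    linarith
  exact_mod_cast hcast

/-- **LOWER child (27851) from the two-sided law (PROVED):** with H_C `σ = e + k + ℓ`, explicit GZ (W-d)
`k + k̄ = g + q + t − 2τ + a` and the conjugate-pair / LowerBalance bound `β ≤ k − k̄` (k3-g6), the exact `m` gives
`2(q + t − 2τ + 2ℓ) + (4e − 2C − ρ + 2g + 2β) ≤ m` — the engine's `m_lower` with the SHARP constant `C = c + δ`.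
[cite: arXiv:1103.6067, Thm. 1.3 p. 6] -/
theorem m_lower_of_exact {m ρ a σ C e k kbar ℓ g q t τ β : ℤ}
    (hm : m = 4 * σ - 2 * C - ρ - 2 * a) (hσ : σ = e + k + ℓ) (hGZ : k + kbar = g + q + t - 2 * τ + a)
    (hβ : β ≤ k - kbar) :
    2 * (q + t - 2 * τ + 2 * ℓ) + (4 * e - 2 * C - ρ + 2 * g + 2 * β) ≤ m := by
  omega

/-- **UPPER sibling (27850) from the same two-sided law (PROVED):** with an upper balance `k − k̄ ≤ β'`,
`m ≤ 2(q + t − 2τ + 2ℓ) + (4e − 2C − ρ + 2g + 2β')` — the sharp constant serves both children and the parent.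
[cite: arXiv:1103.6067, Thm. 1.3 p. 6] -/
theorem m_upper_of_exact {m ρ a σ C e k kbar ℓ g q t τ β' : ℤ}
    (hm : m = 4 * σ - 2 * C - ρ - 2 * a) (hσ : σ = e + k + ℓ) (hGZ : k + kbar = g + q + t - 2 * τ + a)
    (hβ' : k - kbar ≤ β') :
    m ≤ 2 * (q + t - 2 * τ + 2 * ℓ) + (4 * e - 2 * C - ρ + 2 * g + 2 * β') := by
  omega

/-! ## §6 What is NOT here (honest framing)

* REL and CAL are SUB-STUBS of T3's `H_W` (typed VALUE-LEVEL over the carrier records D1/D2/BDP-side, B11/B12: they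
  become registered stubs only after the carriers exist); the tails are H_B (print) and the tree's Katz continuity.
* CAL is ONE certified exact computation per dyadic key (six keys; per (key, 7-type) if the local digit at 7 is not
  tabulated) — kit is not run by this seat (kit_allowed = false); the job spec is on the card (extends R25).
* Nothing about `IsKatzBranch`, Heegner points, `W.sha` or the crux is asserted; BSD is NOT proved by any of this. -/

end Summit.BirchSwinnertonDyer.BirchSwinnertonDyer.Cruxes.SplitBadTwoLowerHalfOfFacts.StubIdeasK3G8

end
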